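import Literature.AlgebraicGeometry.Resolution.NashBlowupToricLoop

/-!
# The toric Nash blow-up LOOP of Castillo–Duarte–Leyton-Álvarez–Liendo (2024) — kernel-checked combinatorics, II:
# the NORMALIZED chart at the loop vertex `v_A`

`Literature/AlgebraicGeometry/Resolution/NashBlowupToricLoopNormalized.lean`, sequel of
`NashBlowupToricLoop.lean` (same source [cite: CastilloEtAl2024], arXiv:2409.19767, pp. 4–6; data `h`, `S`, `U`,
`Uinv`, Lemma 2 `S_eq_closure` and the saturation statement `mem_map_U_iff_tau` from there).

## What this file PROVES (kernel theorems; `decide` for the finite data)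

* §1 The `35` four-element subsets `B ⊂ 𝓗(S)`: all minors have `|det B| ≤ 3` — hence `det_p B = 0 ⟺ det B = 0`
  and `𝒩_p(S) = 𝒩_0(S)` for `p = 0` and all `p ≥ 5` (source p. 6: «`det_p(h_{i₁}…h_{i₄}) = 0` if and only if
  `det_0(h_{i₁}…h_{i₄}) = 0`», for `p ≠ 2, 3`; `28` of the `35` are non-zero — counted in the res-hironaka helper
  `Summits/…/Theorems/HomologicalConductorNashLoopEigenCertificate.lean`, with the eigen-certificate of the loop
  direction, which is OURS and therefore not in `Literature/`).
* §2 THE NORMALIZED LOOP (`closure_normalizedChartGens_eq_map`): at the vertex `v_A = h₁ + h₂ + h₃ + h₅ = (3,4,−1,−1)`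
  of `𝒩_p(S) = conv{v_B : det_p B ≠ 0} + ω` the cone generators — all of `𝓗(S)` (recession cone `ω`) and the `28`
  edge directions `v_B − v_A` — generate EXACTLY `U(S)` as a semigroup, for `p = 0` or `p ≥ 5`.  With
  `mem_map_U_iff_tau` (part I: `U(S)` = all lattice points of the cone `{τ ≥ 0} = Uω`, which therefore contains the
  real cone spanned by these generators) this is `S_{v_A} = cone(𝒩_p(S) − v_A) ∩ ℤ⁴ = U(S) ≅ S`: «the normalized Nash
  blowup of `X` contains an open affine subset isomorphic to `X`» (Main Theorem (ii), `p ∉ {2,3}`; and (i)).  In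
  res-L0-w44-tri-2's words (KC-NASH v1.1 §2): the feasible cone of `𝒩_0(S)` at `v_A` is `F = Uω`, its normal cone is
  `τ = U^{−T}σ`, «the normalised Nash blow-up of `Y` contains a chart isomorphic to `Y`».
NOT here: the other ten vertices of `𝒩_0(S)`; the scheme-level dictionary (quoted in part I); the eigen-certificate
(OURS, Summits helper named above).  Written for the res-hironaka cell (slot W4.4, object U1);
AI-formalised, weaker than expert review.
-/

namespace Literature.AlgebraicGeometry.Resolution

namespace CDLAL

open Matrix

/-! ## §1 The four-element minors of `𝓗(S)` -/

/-- The minor `det(h_a, h_b, h_c, h_d)` of four Hilbert-basis vectors (as columns, in the given order) — the source's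
`det_0(h_{i₁} ⋯ h_{i_d})` (p. 4). [cite: CastilloEtAl2024, §1 p. 4] -/
def det4 (a b c d : Fin 7) : ℤ := (colMatrix ![h a, h b, h c, h d]).det

/-- The point `v_B = h_a + h_b + h_c + h_d` of the Nash polyhedron attached to `B = {h_a, h_b, h_c, h_d}` (source p. 4:
`𝒩_p(S) = conv{(h_{i₁} + ⋯ + h_{i_d}) + ω : det_p ≠ 0}`). [cite: CastilloEtAl2024, §1 p. 4] -/
def vtx (a b c d : Fin 7) : Fin 4 → ℤ := h a + h b + h c + h d

/-- The loop vertex `v_A = h₁ + h₂ + h₃ + h₅ = (3, 4, −1, −1)` (`A = {h₁,h₂,h₃,h₅}`, `det A = −1`). [cite: CastilloEtAl2024, §2 p. 5] -/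
def vA : Fin 4 → ℤ := ![3, 4, -1, -1]

/-- `v_A = h₁ + h₂ + h₃ + h₅` (`A = {h₁,h₂,h₃,h₅}`, source p. 5). [cite: CastilloEtAl2024, §2 p. 5] -/
theorem vtx_chartA : vtx 0 1 2 4 = vA := by decide

/-- Every four-element minor of `𝓗(S)` has absolute value `≤ 3` (values in `{0, ±1, ±2, ±3}`), so it vanishes mod `p`
iff it vanishes, for `p = 0` and all `p ≥ 5` (source p. 6; CDLL: the primes dividing a non-zero minor are `2, 3`). [cite: CastilloEtAl2024, §2 p. 6] -/
theorem abs_det4_le : ∀ a b c d : Fin 7, a < b → b < c → c < d → |det4 a b c d| ≤ 3 := by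
  simp only [abs_le]; decide

/-! ## §2 The normalized chart at `v_A` IS `U(S)` -/

/-- The generators of the cone of the Nash polyhedron `𝒩_p(S)` at `v_A`: all of `𝓗(S)` (the recession cone `ω`) and
the edge directions `v_B − v_A` over the non-degenerate `B = {h_a,h_b,h_c,h_d}`, `a < b < c < d`, `det_p B ≠ 0` read in
`ZMod p` (source p. 4: `S_v = cone(𝒩_p(S) − v) ∩ M`). [cite: CastilloEtAl2024, §1 p. 4] -/
def normalizedChartGens (p : ℕ) : Set (Fin 4 → ℤ) :=
  Set.range h ∪ {v | ∃ a b c d : Fin 7, a < b ∧ b < c ∧ c < d ∧ ((det4 a b c d : ℤ) : ZMod p) ≠ 0 ∧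
    v = vtx a b c d - vA}

/-- Finite check behind `⊆`: all `28` edge directions `v_B − v_A` (`det B ≠ 0`) pull back into `ω` under `U⁻¹` — the
cone of `𝒩_0(S)` at `v_A` lies in `Uω` (the normalized half of the source's verification, p. 5: «this example also
shows the theorem for normalized Nash blowup»). [cite: CastilloEtAl2024, §2 p. 5] -/
theorem inCone_Uinv_vtx : ∀ a b c d : Fin 7, a < b → b < c → c < d → det4 a b c d ≠ 0 →
    InCone (Uinv *ᵥ (vtx a b c d - vA)) := by
  unfold InCone; decide

/-- Finite check behind `⊇`: each `U(h_g)` is `h₁` or an edge direction `v_B − v_A` with `det B ≠ 0`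
(`U h₁ = v_{1236} − v_A`, `U h₂ = v_{1345} − v_A`, `U h₃ = v_{1234} − v_A`, `U h₄ = h₁`, `U h₅ = v_{1256} − v_A`,
`U h₆ = v_{1245} − v_A`, `U h₇ = v_{1357} − v_A`; source p. 5 «`U` induces a bijection from `𝓗(S)` to `H`», each
element of `H` being such an edge direction). [cite: CastilloEtAl2024, §2 p. 5] -/
theorem U_mulVec_h_cases_vtx : ∀ g : Fin 7, U *ᵥ h g = h 0 ∨
    ∃ a b c d : Fin 7, a < b ∧ b < c ∧ c < d ∧ det4 a b c d ≠ 0 ∧ U *ᵥ h g = vtx a b c d - vA := by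
  intro g
  fin_cases g
  · exact Or.inr ⟨0, 1, 2, 5, by decide⟩
  · exact Or.inr ⟨0, 2, 3, 4, by decide⟩
  · exact Or.inr ⟨0, 1, 2, 3, by decide⟩
  · exact Or.inl (by decide)
  · exact Or.inr ⟨0, 1, 4, 5, by decide⟩
  · exact Or.inr ⟨0, 1, 3, 4, by decide⟩
  · exact Or.inr ⟨0, 2, 4, 6, by decide⟩

/-- **THE LOOP, normalized form (Main Theorem (ii) for `p ≥ 5`, and (i)).**  For `p = 0` or `p ≥ 5` the semigroup
generated by `𝓗(S)` and the edge directions `v_B − v_A` (`det_p B ≠ 0`) of `𝒩_p(S)` at `v_A` is EXACTLY `U(S)`.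
Together with `mem_map_U_iff_tau` (`U(S)` = the lattice points of `Uω = {τ ≥ 0}`, a real cone containing all these
generators): `S_{v_A} = cone(𝒩_p(S) − v_A) ∩ ℤ⁴ = U(S)`, and `U : S ≅ S_{v_A}` — «the normalized Nash blowup of `X`
contains an open affine subset isomorphic to `X`» (source p. 5: «since we started with a normal variety `X(S)` … this
example also shows the theorem for normalized Nash blowup»; p. 6 for `p ≠ 2, 3`). [cite: CastilloEtAl2024, Main Theorem (i)(ii) / §2 pp. 5–6] -/
theorem closure_normalizedChartGens_eq_map (p : ℕ) (hp : p = 0 ∨ 5 ≤ p) :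
    AddSubmonoid.closure (normalizedChartGens p) = S.map (Matrix.mulVecLin U) := by
  refine le_antisymm (AddSubmonoid.closure_le.2 ?_) ?_
  · rintro v (⟨g, rfl⟩ | ⟨a, b, c, d, hab, hbc, hcd, hd, rfl⟩)
    · exact (mem_map_U_iff _).2 (inCone_Uinv_h g)
    · refine (mem_map_U_iff _).2 (inCone_Uinv_vtx a b c d hab hbc hcd ?_)
      rintro h0
      exact hd (by rw [h0]; simp)
  · rw [S_eq_closure, AddSubmonoid.map_le_iff_le_comap, AddSubmonoid.closure_le]
    rintro _ ⟨g, rfl⟩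
    rw [SetLike.mem_coe, AddSubmonoid.mem_comap, Matrix.mulVecLin_apply]
    refine AddSubmonoid.subset_closure ?_
    rcases U_mulVec_h_cases_vtx g with h0 | ⟨a, b, c, d, hab, hbc, hcd, hd, he⟩
    · exact Or.inl ⟨0, h0.symm⟩
    · exact Or.inr ⟨a, b, c, d, hab, hbc, hcd,
        (intCast_zmod_ne_zero_iff hp (abs_det4_le a b c d hab hbc hcd)).2 hd, he⟩

/-- Corollary: the normalized chart generators all satisfy the six `τ`-inequalities (they lie in `U(S) ⊆ Uω`), so the
real cone they span is contained in `Uω` and its lattice points are exactly `U(S)` (by `mem_map_U_iff_tau`) — the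
normalized chart `S_{v_A} = cone(𝒩_p(S) − v_A) ∩ M` of p. 4 is `U(S)`. [cite: CastilloEtAl2024, §1 p. 4 / §2 p. 5] -/
theorem normalizedChartGens_tau_nonneg (p : ℕ) (hp : p = 0 ∨ 5 ≤ p) (v : Fin 4 → ℤ)
    (hv : v ∈ normalizedChartGens p) (j : Fin 6) : 0 ≤ tauNormal j ⬝ᵥ v :=
  (mem_map_U_iff_tau v).1 ((closure_normalizedChartGens_eq_map p hp).le (AddSubmonoid.subset_closure hv)) j

end CDLAL

end Literature.AlgebraicGeometry.Resolution
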